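/- Width seat `ym-line-cbag-p1-w2` (prover-ym-line-cbag-p1-w2-g15-0; own items stmt-QuantumFields-22254 / 22893 CLOSED) on the
planner-of-record's LINE 4, route `U1DipoleHelicity`, crux `WilsonU1DipoleLawD4` (stmt-QuantumFields-25880): THE GAUSSIAN HALF OF
STUB 1 — the pure spin-wave part of the Villain two-plaquette function of the free-boundary cube satisfies `stub_villainDipoleCalibration`
verbatim (same quantifiers, same `β'` for all `z`, error `(C/βV)(1+|z|₁)⁻⁵`, `C·Σw ≤ ε`, eventually in the cube size).  Helper
`--supports stmt-QuantumFields-25880`; no stub is closed here (the monopole / flux-gas factors `A^∓` are set to `1`).  Nothing in this file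
bears on the Yang–Mills mass gap. -/
import Summits.QuantumFields.YangMills.Theorems.U1DipoleHelicityVillainSpinWaveKernelLimit
import Summits.QuantumFields.YangMills.Theorems.U1DipoleHelicitySpinWaveCalibration
import HarnessLib

/-!
# Crux `WilsonU1DipoleLawD4` (stmt-QuantumFields-25880): the spin-wave dipole law of the Villain cube in the shape of stub 1

`villainPlaqCorr_eq_spinWave_gas`: `V_{βV,n}(z) = ½e^{−(E_p+E_q)/2βV}(e^{B/βV}A⁻ − e^{−B/βV}A⁺)` on the cube `B_{2n+1}`.  Setting the
flux-gas averages `A^∓` to `1` leaves the SPIN-WAVE VALUE `SW_n(βV,z) = ½e^{−(E_p+E_q)/2βV}(e^{B/βV} − e^{−B/βV})`.  This file proves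

* `tendsto_villainSpinWave`: `SW_n(βV,z) → e^{−K(0)/βV} sinh(K(z)/βV)` as `n → ∞` (`K = freeK`; kernel limits of
  `U1DipoleHelicityVillainSpinWaveKernelLimit`, continuity);
* **`villainSpinWave_dipoleCalibration`**:
  `∀ ε > 0, ∃ β₁ ≥ 1, ∀ βV > β₁, ∃ β' > 0, ∃ C ≥ 0, C·Σ_z w(z) ≤ ε ∧ ∀ z, ∀ᶠ n, |SW_n(βV,z) − K(z)/β'| ≤ (C/βV)·w(z)`
  — word for word the registered stub `stub_villainDipoleCalibration` with `villainPlaqCorr βV n z` replaced by its spin-wave part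
  (`β' = βV e^{1/(2βV)}`).

So stub 1 is EXACTLY the statement that the flux-gas factors `A^∓_n(z)` may be absorbed: what remains is the monopole content (renormalised
clustering of the `d = 4` Coulomb gas of Fröhlich–Spencer's duality; sizing note on the item), nothing Gaussian.  RECORD-type material on an
abelian comparison line; the Yang–Mills mass gap is NOT proved by anything here.
-/

set_option autoImplicit false

noncomputable section

namespace Summit.QuantumFields.YangMills.Theorems.U1DipoleHelicity

open Finset Filter Topology
open scoped Real Matrix
open Literature.Probability.LatticeModels Literature.MathematicalPhysics.QuantumFieldTheory
open Literature.MathematicalPhysics.QuantumFieldTheory.VillainAngle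
open Literature.Probability.LatticeModels.GaussianCoord (gram exactEnergy)

/-! ### A squeeze lemma -/

/-- If `|f n − L| ≤ K/n⁴` for `n ≥ N` then `f n → L`. [folklore] -/
theorem tendsto_of_abs_sub_le_div_pow_four {f : ℕ → ℝ} {L K : ℝ} {N : ℕ} (hK : 0 ≤ K)
    (h : ∀ n : ℕ, N ≤ n → |f n - L| ≤ K / (n : ℝ) ^ 4) : Tendsto f atTop (𝓝 L) := by
  rw [tendsto_iff_norm_sub_tendsto_zero]
  refine squeeze_zero' (Eventually.of_forall fun n => norm_nonneg _) ?_ (tendsto_const_div_atTop_nhds_zero_nat K)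
  rw [eventually_atTop]
  refine ⟨max N 1, fun n hn => ?_⟩
  have hN : N ≤ n := le_trans (le_max_left _ _) hn
  have h1 : 1 ≤ n := le_trans (le_max_right _ _) hn
  have h1' : (1 : ℝ) ≤ n := by exact_mod_cast h1
  rw [Real.norm_eq_abs]
  refine (h n hN).trans ?_
  exact div_le_div_of_nonneg_left hK (by positivity) (by nlinarith [pow_le_pow_left₀ zero_le_one h1' 3])

/-! ### The spin-wave value of the cube and its limit -/

/-- **The spin-wave value of the cube converges**: with `p = (n𝟙;0,1)`, `q = (z+n𝟙;0,1)` in `B_{2n+1}`,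
`½e^{−(E_p+E_q)/2βV}(e^{B/βV} − e^{−B/βV}) → e^{−K(0)/βV} sinh(K(z)/βV)` as `n → ∞` (`βV ≠ 0`; the cube quantities are extended by `0`
below `n = ‖z‖_∞ + 1`, where the plaquettes are not in the cube). [folklore] -/
theorem tendsto_villainSpinWave (βV : ℝ) (z : Literature.Probability.LatticeModels.Site 4) :
    Tendsto (fun n : ℕ => if hn : Site.supNorm z + 1 ≤ n then
        1 / 2 * Real.exp (-(exactEnergy dMat (Pi.single (⟨(diag 4 n, 0, 1), diag_mem_plaquettesIn (one_le_of_supNorm_succ_le z hn)⟩ :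
              PIdx 4 (2 * n + 1)) (1 : ℝ)) +
            exactEnergy dMat (Pi.single (⟨(z + diag 4 n, 0, 1), add_diag_mem_plaquettesIn z hn⟩ : PIdx 4 (2 * n + 1)) (1 : ℝ))) /
            (2 * βV)) *
          (Real.exp (((dMatᵀ *ᵥ (Pi.single (⟨(diag 4 n, 0, 1), diag_mem_plaquettesIn (one_le_of_supNorm_succ_le z hn)⟩ :
                  PIdx 4 (2 * n + 1)) (1 : ℝ) : PIdx 4 (2 * n + 1) → ℝ)) ⬝ᵥ
                ((gram (dMat (d := 4) (n := 2 * n + 1)))⁻¹ *ᵥ (dMatᵀ *ᵥ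
                  (Pi.single (⟨(z + diag 4 n, 0, 1), add_diag_mem_plaquettesIn z hn⟩ : PIdx 4 (2 * n + 1)) (1 : ℝ) :
                    PIdx 4 (2 * n + 1) → ℝ)))) / βV) -
            Real.exp (-((dMatᵀ *ᵥ (Pi.single (⟨(diag 4 n, 0, 1), diag_mem_plaquettesIn (one_le_of_supNorm_succ_le z hn)⟩ :
                  PIdx 4 (2 * n + 1)) (1 : ℝ) : PIdx 4 (2 * n + 1) → ℝ)) ⬝ᵥ
                ((gram (dMat (d := 4) (n := 2 * n + 1)))⁻¹ *ᵥ (dMatᵀ *ᵥ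
                  (Pi.single (⟨(z + diag 4 n, 0, 1), add_diag_mem_plaquettesIn z hn⟩ : PIdx 4 (2 * n + 1)) (1 : ℝ) :
                    PIdx 4 (2 * n + 1) → ℝ)))) / βV))
        else 0)
      atTop (𝓝 (Real.exp (-(freeK 0 / βV)) * Real.sinh (freeK z / βV))) := by
  obtain ⟨K, hK0, hK⟩ := exists_villainKernel_freeK_bound
  -- the three Gaussian data as functions of `n` (extended by junk below the membership threshold)
  set Ep : ℕ → ℝ := fun n => if hn : Site.supNorm z + 1 ≤ n then
      exactEnergy dMat (Pi.single (⟨(diag 4 n, 0, 1), diag_mem_plaquettesIn (one_le_of_supNorm_succ_le z hn)⟩ :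
        PIdx 4 (2 * n + 1)) (1 : ℝ)) else 1 / 2 with hEp
  set Eq' : ℕ → ℝ := fun n => if hn : Site.supNorm z + 1 ≤ n then
      exactEnergy dMat (Pi.single (⟨(z + diag 4 n, 0, 1), add_diag_mem_plaquettesIn z hn⟩ : PIdx 4 (2 * n + 1)) (1 : ℝ))
      else 1 / 2 with hEq
  set Bn : ℕ → ℝ := fun n => if hn : Site.supNorm z + 1 ≤ n then
      (dMatᵀ *ᵥ (Pi.single (⟨(diag 4 n, 0, 1), diag_mem_plaquettesIn (one_le_of_supNorm_succ_le z hn)⟩ :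
            PIdx 4 (2 * n + 1)) (1 : ℝ) : PIdx 4 (2 * n + 1) → ℝ)) ⬝ᵥ
          ((gram (dMat (d := 4) (n := 2 * n + 1)))⁻¹ *ᵥ (dMatᵀ *ᵥ
            (Pi.single (⟨(z + diag 4 n, 0, 1), add_diag_mem_plaquettesIn z hn⟩ : PIdx 4 (2 * n + 1)) (1 : ℝ) :
              PIdx 4 (2 * n + 1) → ℝ)))
      else freeK z with hBn
  -- a common threshold
  set N : ℕ := max (max 32 (8 * Site.supNorm z)) (Site.supNorm z + 1) with hN
  have hNmem : ∀ n, N ≤ n → Site.supNorm z + 1 ≤ n := fun n hn => le_trans (le_max_right _ _) hn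
  have hN32 : ∀ n, N ≤ n → (32 : ℝ) ≤ n := fun n hn => by
    have : 32 ≤ n := le_trans (le_trans (le_max_left _ _) (le_max_left _ _)) hn
    exact_mod_cast this
  have hN8 : ∀ n, N ≤ n → 8 * (Site.supNorm z : ℝ) ≤ n := fun n hn => by
    have : 8 * Site.supNorm z ≤ n := le_trans (le_trans (le_max_right _ _) (le_max_left _ _)) hn
    exact_mod_cast this
  have hEp_t : Tendsto Ep atTop (𝓝 (1 / 2)) := by
    refine tendsto_of_abs_sub_le_div_pow_four (N := N) hK0 fun n hn => ?_
    have h := (hK z n (hNmem n hn) (hN32 n hn) (hN8 n hn)).2.1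
    simp only [hEp, dif_pos (hNmem n hn)]
    exact h
  have hEq_t : Tendsto Eq' atTop (𝓝 (1 / 2)) := by
    refine tendsto_of_abs_sub_le_div_pow_four (N := N) hK0 fun n hn => ?_
    have h := (hK z n (hNmem n hn) (hN32 n hn) (hN8 n hn)).2.2
    simp only [hEq, dif_pos (hNmem n hn)]
    exact h
  have hBn_t : Tendsto Bn atTop (𝓝 (freeK z)) := by
    refine tendsto_of_abs_sub_le_div_pow_four (N := N) hK0 fun n hn => ?_
    have h := (hK z n (hNmem n hn) (hN32 n hn) (hN8 n hn)).1
    simp only [hBn, dif_pos (hNmem n hn)]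
    exact h
  -- continuity
  have h1 : Tendsto (fun n => Real.exp (-(Ep n + Eq' n) / (2 * βV))) atTop (𝓝 (Real.exp (-(1 / 2 + 1 / 2) / (2 * βV)))) :=
    (Real.continuous_exp.tendsto _).comp (((hEp_t.add hEq_t).neg).div_const _)
  have h2 : Tendsto (fun n => Real.exp (Bn n / βV)) atTop (𝓝 (Real.exp (freeK z / βV))) :=
    (Real.continuous_exp.tendsto _).comp (hBn_t.div_const _)
  have h3 : Tendsto (fun n => Real.exp (-Bn n / βV)) atTop (𝓝 (Real.exp (-freeK z / βV))) :=
    (Real.continuous_exp.tendsto _).comp (hBn_t.neg.div_const _)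
  have hG : Tendsto (fun n => 1 / 2 * Real.exp (-(Ep n + Eq' n) / (2 * βV)) * (Real.exp (Bn n / βV) - Real.exp (-Bn n / βV)))
      atTop (𝓝 (1 / 2 * Real.exp (-(1 / 2 + 1 / 2) / (2 * βV)) * (Real.exp (freeK z / βV) - Real.exp (-freeK z / βV)))) :=
    (h1.const_mul (1 / 2)).mul (h2.sub h3)
  -- the limit value is `e^{-K(0)/β} sinh(K(z)/β)`
  have hL : 1 / 2 * Real.exp (-(1 / 2 + 1 / 2) / (2 * βV)) * (Real.exp (freeK z / βV) - Real.exp (-freeK z / βV)) =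
      Real.exp (-(freeK 0 / βV)) * Real.sinh (freeK z / βV) := by
    rw [Real.sinh_eq, freeK_zero, neg_div βV (freeK z)]
    have e : -(1 / 2 + 1 / 2 : ℝ) / (2 * βV) = -(1 / 2 / βV) := by ring
    rw [e]
    ring
  rw [← hL]
  -- the target function agrees with `G` eventually
  refine hG.congr' ?_
  rw [EventuallyEq, eventually_atTop]
  refine ⟨Site.supNorm z + 1, fun n hn => ?_⟩
  simp only [hEp, hEq, hBn, dif_pos hn]

/-! ### The Gaussian half of stub 1 -/

/-- **The spin-wave dipole law of the Villain cube, in the exact shape of `stub_villainDipoleCalibration`.**  For every `ε > 0` there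
is `β₁ ≥ 1` such that for every `βV > β₁` there are `β' > 0` (`= βV e^{1/(2βV)}`) and `C ≥ 0` with `C·Σ_z w(z) ≤ ε` and, for every
`z ∈ ℤ⁴`, eventually in the cube size `n`,
`|½e^{−(E_p+E_q)/2βV}(e^{B/βV} − e^{−B/βV}) − freeK z/β'| ≤ (C/βV)·weight z`
(`p = (n𝟙;0,1)`, `q = (z+n𝟙;0,1)` in `B_{2n+1}`; `E_p, E_q, B` the Villain spin-wave data of `villainPlaqCorr_eq_spinWave_gas`).  This is the
registered stub with the flux-gas factors `A^∓` replaced by `1`: the Gaussian half of the Villain calibration is a theorem; the other half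
is the monopole gas. [cite: FrohlichSpencerCMP1982, §2.11 (2.89)–(2.90)] -/
theorem villainSpinWave_dipoleCalibration :
    ∀ ε : ℝ, 0 < ε → ∃ β₁ : ℝ, 1 ≤ β₁ ∧ ∀ βV : ℝ, β₁ < βV → ∃ β' : ℝ, 0 < β' ∧ ∃ C : ℝ, 0 ≤ C ∧
      C * (∑' z, weight z) ≤ ε ∧ ∀ z : Literature.Probability.LatticeModels.Site 4, ∀ᶠ n : ℕ in atTop,
        ∀ hn : Site.supNorm z + 1 ≤ n,
        |1 / 2 * Real.exp (-(exactEnergy dMat (Pi.single (⟨(diag 4 n, 0, 1), diag_mem_plaquettesIn (one_le_of_supNorm_succ_le z hn)⟩ :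
              PIdx 4 (2 * n + 1)) (1 : ℝ)) +
            exactEnergy dMat (Pi.single (⟨(z + diag 4 n, 0, 1), add_diag_mem_plaquettesIn z hn⟩ : PIdx 4 (2 * n + 1)) (1 : ℝ))) /
            (2 * βV)) *
          (Real.exp (((dMatᵀ *ᵥ (Pi.single (⟨(diag 4 n, 0, 1), diag_mem_plaquettesIn (one_le_of_supNorm_succ_le z hn)⟩ :
                  PIdx 4 (2 * n + 1)) (1 : ℝ) : PIdx 4 (2 * n + 1) → ℝ)) ⬝ᵥ
                ((gram (dMat (d := 4) (n := 2 * n + 1)))⁻¹ *ᵥ (dMatᵀ *ᵥ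
                  (Pi.single (⟨(z + diag 4 n, 0, 1), add_diag_mem_plaquettesIn z hn⟩ : PIdx 4 (2 * n + 1)) (1 : ℝ) :
                    PIdx 4 (2 * n + 1) → ℝ)))) / βV) -
            Real.exp (-((dMatᵀ *ᵥ (Pi.single (⟨(diag 4 n, 0, 1), diag_mem_plaquettesIn (one_le_of_supNorm_succ_le z hn)⟩ :
                  PIdx 4 (2 * n + 1)) (1 : ℝ) : PIdx 4 (2 * n + 1) → ℝ)) ⬝ᵥ
                ((gram (dMat (d := 4) (n := 2 * n + 1)))⁻¹ *ᵥ (dMatᵀ *ᵥ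
                  (Pi.single (⟨(z + diag 4 n, 0, 1), add_diag_mem_plaquettesIn z hn⟩ : PIdx 4 (2 * n + 1)) (1 : ℝ) :
                    PIdx 4 (2 * n + 1) → ℝ)))) / βV)) - freeK z / β'| ≤ C / βV * weight z := by
  intro ε hε
  obtain ⟨β₀, C, hβ₀, hC, H⟩ := abs_spinWave_sub_le
  set S : ℝ := ∑' z, weight z with hS
  have hS0 : 0 ≤ S := tsum_nonneg fun z => (weight_pos z).le
  refine ⟨max β₀ ((C + 1) * S / ε), le_trans hβ₀ (le_max_left _ _), fun βV hβ => ?_⟩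
  have hβ0' : β₀ ≤ βV := le_of_lt (lt_of_le_of_lt (le_max_left _ _) hβ)
  have hβpos : 0 < βV := by linarith
  have hβε : (C + 1) * S / ε < βV := lt_of_le_of_lt (le_max_right _ _) hβ
  refine ⟨βV * Real.exp (freeK 0 / βV), by positivity, (C + 1) / βV, by positivity, ?_, fun z => ?_⟩
  · rw [div_mul_eq_mul_div, div_le_iff₀ hβpos]
    have := (div_lt_iff₀ hε).1 hβε
    linarith
  · -- the infinite-volume spin-wave value is within `(C/βV²) w(z)` of `K(z)/β'`
    have hlim := H βV hβ0' z
    -- the cube's value is eventually within `w(z)/βV²` of the infinite-volume one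
    have hw : 0 < weight z / βV ^ 2 := by have := weight_pos z; positivity
    have hev := (tendsto_villainSpinWave βV z) (Metric.ball_mem_nhds _ hw)
    rw [Filter.mem_map] at hev
    filter_upwards [hev, eventually_ge_atTop (Site.supNorm z + 1)] with n hn hn1
    intro hn'
    simp only [Set.mem_preimage, dif_pos hn1, Metric.mem_ball, Real.dist_eq] at hn
    have key : C / βV ^ 2 * weight z + weight z / βV ^ 2 = (C + 1) / βV / βV * weight z := by
      field_simp
    rw [← key]
    calc _ ≤ |1 / 2 * Real.exp (-(exactEnergy dMat (Pi.single (⟨(diag 4 n, 0, 1), diag_mem_plaquettesIn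
                (one_le_of_supNorm_succ_le z hn')⟩ : PIdx 4 (2 * n + 1)) (1 : ℝ)) +
              exactEnergy dMat (Pi.single (⟨(z + diag 4 n, 0, 1), add_diag_mem_plaquettesIn z hn'⟩ : PIdx 4 (2 * n + 1)) (1 : ℝ))) /
              (2 * βV)) *
            (Real.exp (((dMatᵀ *ᵥ (Pi.single (⟨(diag 4 n, 0, 1), diag_mem_plaquettesIn (one_le_of_supNorm_succ_le z hn')⟩ :
                    PIdx 4 (2 * n + 1)) (1 : ℝ) : PIdx 4 (2 * n + 1) → ℝ)) ⬝ᵥ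
                  ((gram (dMat (d := 4) (n := 2 * n + 1)))⁻¹ *ᵥ (dMatᵀ *ᵥ
                    (Pi.single (⟨(z + diag 4 n, 0, 1), add_diag_mem_plaquettesIn z hn'⟩ : PIdx 4 (2 * n + 1)) (1 : ℝ) :
                      PIdx 4 (2 * n + 1) → ℝ)))) / βV) -
              Real.exp (-((dMatᵀ *ᵥ (Pi.single (⟨(diag 4 n, 0, 1), diag_mem_plaquettesIn (one_le_of_supNorm_succ_le z hn')⟩ :
                    PIdx 4 (2 * n + 1)) (1 : ℝ) : PIdx 4 (2 * n + 1) → ℝ)) ⬝ᵥ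
                  ((gram (dMat (d := 4) (n := 2 * n + 1)))⁻¹ *ᵥ (dMatᵀ *ᵥ
                    (Pi.single (⟨(z + diag 4 n, 0, 1), add_diag_mem_plaquettesIn z hn'⟩ : PIdx 4 (2 * n + 1)) (1 : ℝ) :
                      PIdx 4 (2 * n + 1) → ℝ)))) / βV)) -
            Real.exp (-(freeK 0 / βV)) * Real.sinh (freeK z / βV)| +
          |Real.exp (-(freeK 0 / βV)) * Real.sinh (freeK z / βV) - freeK z / (βV * Real.exp (freeK 0 / βV))| :=
          abs_sub_le _ _ _
      _ ≤ weight z / βV ^ 2 + C / βV ^ 2 * weight z := add_le_add (le_of_lt hn) hlim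
      _ = C / βV ^ 2 * weight z + weight z / βV ^ 2 := add_comm _ _

end Summit.QuantumFields.YangMills.Theorems.U1DipoleHelicity

end
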